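import Literature.NumberTheory.Automorphic.IntegralWeightHeckeModuleGL2
import Mathlib.RingTheory.TensorProduct.Free
import Mathlib.LinearAlgebra.TensorProduct.Quotient
import HarnessLib

/-!
# Base change and reduction of the integral binary forms `Sym^m(𝒪²)`

Topic `NumberTheory/Automorphic`; namespace `Literature.NumberTheory.Automorphic.IntegralWeightGL2`
(continuing the `SymPow` story of `IntegralWeightHeckeModuleGL2`); definitions with bodies and
theorems.

`SymPow 𝒪 m` is the free `𝒪`-module of forms of degree `m` in `X₀, X₁` with the INTEGRAL action
`symPowAction 𝒪 m` of the matrix monoid `M₂(𝒪)` by linear substitution — Hida's `L(m; A)`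
([Hida1994AIF, §1]).  Its formation commutes with base change ([Hida1994AIF, §1, (1.2b)]: "`L(n; A)
= L(n; 𝒪) ⊗ A`"), which is how the `ϖ`-adic lattice `Sym^m(𝒪²) ⊂ Sym^m(E²)` and its reductions
`Sym^m(𝒪²)/ϖ^r = Sym^m((𝒪/ϖ^r)²)` enter Hida theory ([KhareThorne2017, §6.4–6.5]):

* `map_linSubst` — `MvPolynomial.map f ∘ linSubst g = linSubst (g.map f) ∘ map f`;
* `symPowMap f m : SymPow 𝒪 m →ₛₗ[f] SymPow A m` (coefficientwise `f`), equivariant: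
  `symPowMap_symPowAction : f_* (g · p) = (g.map f) · f_* p`;
* `symPowBasis 𝒪 m` — the monomial basis `X₀^a X₁^{m-a}` (indexed by the exponents of degree `m`);
* **`symPowBaseChange m : A ⊗[𝒪] SymPow 𝒪 m ≃ₗ[A] SymPow A m`** for an `𝒪`-algebra `A`, with
  `symPowBaseChange_tmul : a ⊗ p ↦ a • f_* p` and the EQUIVARIANCE
  `symPowBaseChange_symPowAction` (`M₂(𝒪)` acting on `A ⊗ Sym^m(𝒪²)` through the left factor
  trivially, on `Sym^m(A²)` through `g.map (algebraMap 𝒪 A)`);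
* **`symPowQuotEquiv I m : SymPow 𝒪 m ⧸ I • Sym^m ≃ₗ[𝒪] SymPow (𝒪 ⧸ I) m`** (reduction modulo an
  ideal, e.g. `I = (ϖ^r)`), `symPowQuotEquiv_mk`, and its equivariance
  `symPowQuotEquiv_symPowAction`.

## References

* H. Hida, *p-adic ordinary Hecke algebras for GL(2)*, Ann. Inst. Fourier 44 (1994), §1 (held).
  [Hida1994AIF]
* C. Khare, J. A. Thorne, Amer. J. Math. 139 (2017), §6.4–6.5 (arXiv:1409.7007, held).
  [KhareThorne2017]
-/

noncomputable section

open scoped TensorProduct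
open MvPolynomial

namespace Literature.NumberTheory.Automorphic.IntegralWeightGL2

open Literature.Computability.AlgebraicComplexity

variable {O A : Type} [CommRing O] [CommRing A]

/-! ### Linear substitution commutes with change of coefficients -/

/-- **`map f (linSubst g p) = linSubst (g.map f) (map f p)`.** [folklore] -/
theorem map_linSubst {σ : Type} [Fintype σ] [DecidableEq σ] (f : O →+* A) (g : Matrix σ σ O)
    (p : MvPolynomial σ O) :
    map f (linSubst σ O g p) = linSubst σ A (g.map f) (map f p) := by
  induction p using MvPolynomial.induction_on with
  | C c => rw [linSubst_C, map_C, linSubst_C]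
  | add p q hp hq => rw [map_add, map_add, hp, hq, map_add, map_add]
  | mul_X p i hp =>
    rw [map_mul, map_mul, hp, map_mul, map_X, map_mul, linSubst_X, linSubst_X, map_sum]
    congr 1
    refine Finset.sum_congr rfl fun j _ => ?_
    rw [smul_eq_C_mul, smul_eq_C_mul, map_mul, map_C, map_X, Matrix.map_apply]

/-! ### Change of coefficients on forms of degree `m` -/

/-- **`f_* : Sym^m(𝒪²) → Sym^m(A²)`**, coefficientwise `f` (an `f`-semilinear map). [cite: Hida1994AIF, §1] -/
def symPowMap (f : O →+* A) (m : ℕ) : SymPow O m →ₛₗ[f] SymPow A m where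
  toFun p := ⟨map f (p : MvPolynomial (Fin 2) O), (mem_homogeneousSubmodule _ _).2 (p.2.map f)⟩
  map_add' p q := Subtype.ext (by simp)
  map_smul' c p := Subtype.ext (by
    change map f (c • (p : MvPolynomial (Fin 2) O)) = f c • map f (p : MvPolynomial (Fin 2) O)
    rw [smul_eq_C_mul, map_mul, map_C, smul_eq_C_mul])

/-- Unfolding `symPowMap`. [folklore] -/
@[simp]
theorem coe_symPowMap_apply (f : O →+* A) (m : ℕ) (p : SymPow O m) :
    ((symPowMap f m p : SymPow A m) : MvPolynomial (Fin 2) A) = map f (p : MvPolynomial (Fin 2) O) :=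
  rfl

/-- **`f_*` is equivariant**: `f_* (g · p) = (g.map f) · f_* p`. [cite: Hida1994AIF, §1] -/
theorem symPowMap_symPowAction (f : O →+* A) (m : ℕ) (g : Matrix (Fin 2) (Fin 2) O)
    (p : SymPow O m) :
    symPowMap f m (symPowAction O m g p) = symPowAction A m (g.map f) (symPowMap f m p) :=
  Subtype.ext (by
    rw [coe_symPowMap_apply, coe_symPowAction_apply, coe_symPowAction_apply, coe_symPowMap_apply,
      map_linSubst])

/-- `f_*` as an `𝒪`-linear map into the restriction of scalars (for an `𝒪`-algebra `A`).
[folklore] -/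
def symPowMapₗ [Algebra O A] (m : ℕ) : SymPow O m →ₗ[O] SymPow A m where
  toFun := symPowMap (algebraMap O A) m
  map_add' p q := map_add _ p q
  map_smul' c p := by
    rw [LinearMap.map_smulₛₗ, RingHom.id_apply, algebraMap_smul]

/-- Unfolding `symPowMapₗ`. [folklore] -/
@[simp]
theorem symPowMapₗ_apply [Algebra O A] (m : ℕ) (p : SymPow O m) :
    symPowMapₗ (A := A) m p = symPowMap (algebraMap O A) m p :=
  rfl

/-! ### The monomial basis -/

variable (O)

/-- The exponents of degree `m` (index set of the monomial basis `X₀^a X₁^{m−a}`). [folklore] -/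
abbrev Exponents (m : ℕ) : Type :=
  {d : Fin 2 →₀ ℕ // d.degree = m}

/-- The monomial `X^d ∈ Sym^m(𝒪²)` for an exponent of degree `m`. [folklore] -/
def symPowMonomial (m : ℕ) (d : Exponents m) : SymPow O m :=
  ⟨monomial d.1 1, (mem_homogeneousSubmodule _ _).2 (isHomogeneous_monomial 1 d.2)⟩

/-- Unfolding `symPowMonomial`. [folklore] -/
@[simp]
theorem coe_symPowMonomial (m : ℕ) (d : Exponents m) :
    ((symPowMonomial O m d : SymPow O m) : MvPolynomial (Fin 2) O) = monomial d.1 1 :=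
  rfl

/-- A form of degree `m` is the sum of its monomials of degree `m`. [folklore] -/
theorem sum_coeff_smul_symPowMonomial (m : ℕ) (p : SymPow O m) [DecidableEq (Fin 2 →₀ ℕ)] :
    ∑ d ∈ (p : MvPolynomial (Fin 2) O).support.subtype (fun d => d.degree = m),
        coeff d.1 (p : MvPolynomial (Fin 2) O) • symPowMonomial O m d = p := by
  refine Subtype.ext ?_
  rw [Submodule.coe_sum]
  simp_rw [Submodule.coe_smul, coe_symPowMonomial, smul_monomial, smul_eq_mul, mul_one]
  rw [Finset.sum_subtype_eq_sum_filter (f := fun d => monomial d (coeff d (p : MvPolynomial (Fin 2) O))),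
    Finset.filter_true_of_mem fun d hd => ?_]
  · exact (as_sum (p : MvPolynomial (Fin 2) O)).symm
  · by_contra h
    exact (mem_support_iff.1 hd) (p.2.coeff_eq_zero h)

/-- The monomials of degree `m` are linearly independent in `Sym^m(𝒪²)`. [folklore] -/
theorem linearIndependent_symPowMonomial (m : ℕ) : LinearIndependent O (symPowMonomial O m) := by
  refine LinearIndependent.of_comp (Submodule.subtype _) ?_
  have h : (Submodule.subtype _) ∘ symPowMonomial O m =
      (basisMonomials (Fin 2) O : (Fin 2 →₀ ℕ) → MvPolynomial (Fin 2) O) ∘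
        (Subtype.val : Exponents m → Fin 2 →₀ ℕ) := by
    funext d
    rw [coe_basisMonomials]
    rfl
  rw [h]
  exact (basisMonomials (Fin 2) O).linearIndependent.comp _ Subtype.val_injective

/-- The monomials of degree `m` span `Sym^m(𝒪²)`. [folklore] -/
theorem span_symPowMonomial (m : ℕ) : ⊤ ≤ Submodule.span O (Set.range (symPowMonomial O m)) := by
  classical
  intro p _
  rw [← sum_coeff_smul_symPowMonomial O m p]
  exact Submodule.sum_mem _ fun d _ => Submodule.smul_mem _ _ (Submodule.subset_span ⟨d, rfl⟩)

/-- **The monomial basis of `Sym^m(𝒪²)`.** [cite: Hida1994AIF, §1] -/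
def symPowBasis (m : ℕ) : Module.Basis (Exponents m) O (SymPow O m) :=
  Module.Basis.mk (linearIndependent_symPowMonomial O m) (span_symPowMonomial O m)

/-- The monomial basis consists of the monomials. [folklore] -/
@[simp]
theorem symPowBasis_apply (m : ℕ) (d : Exponents m) : symPowBasis O m d = symPowMonomial O m d :=
  Module.Basis.mk_apply _ _ d

variable {O}

/-- `f_*` maps monomials to monomials. [folklore] -/
theorem symPowMap_symPowMonomial (f : O →+* A) (m : ℕ) (d : Exponents m) :
    symPowMap f m (symPowMonomial O m d) = symPowMonomial A m d :=
  Subtype.ext (by rw [coe_symPowMap_apply, coe_symPowMonomial, coe_symPowMonomial, map_monomial, map_one])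

/-! ### Base change -/

section BaseChange

variable [Algebra O A] (m : ℕ)

variable (A) in
/-- **`A ⊗_𝒪 Sym^m(𝒪²) ≅ Sym^m(A²)`** (`L(m; A) = L(m; 𝒪) ⊗ A`), the `A`-linear equivalence
matching the monomial bases. [cite: Hida1994AIF, §1, (1.2b)] -/
def symPowBaseChange : A ⊗[O] SymPow O m ≃ₗ[A] SymPow A m :=
  (Algebra.TensorProduct.basis A (symPowBasis O m)).equiv (symPowBasis A m) (Equiv.refl _)

/-- `symPowBaseChange` as a linear map is the base change of `f_*`. [folklore] -/
theorem symPowBaseChange_toLinearMap :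
    (symPowBaseChange (O := O) A m).toLinearMap = (symPowMapₗ (A := A) m).liftBaseChange A := by
  refine (Algebra.TensorProduct.basis A (symPowBasis O m)).ext fun d => ?_
  rw [LinearEquiv.coe_coe, symPowBaseChange, Module.Basis.equiv_apply, Equiv.refl_apply,
    Algebra.TensorProduct.basis_apply, LinearMap.liftBaseChange_tmul, one_smul, symPowMapₗ_apply,
    symPowBasis_apply, symPowBasis_apply, symPowMap_symPowMonomial]

/-- **`symPowBaseChange (a ⊗ p) = a • f_* p`.** [cite: Hida1994AIF, §1, (1.2b)] -/
@[simp]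
theorem symPowBaseChange_tmul (a : A) (p : SymPow O m) :
    symPowBaseChange A m (a ⊗ₜ p) = a • symPowMap (algebraMap O A) m p := by
  rw [← LinearEquiv.coe_coe, symPowBaseChange_toLinearMap, LinearMap.liftBaseChange_tmul,
    symPowMapₗ_apply]

/-- **Base change is `M₂(𝒪)`-equivariant**: `M₂(𝒪)` acting on `A ⊗ Sym^m(𝒪²)` through the
right factor and on `Sym^m(A²)` through `g.map (algebraMap 𝒪 A)`. [cite: Hida1994AIF, §1] -/
theorem symPowBaseChange_symPowAction (g : Matrix (Fin 2) (Fin 2) O) (x : A ⊗[O] SymPow O m) :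
    symPowBaseChange A m ((symPowAction O m g).baseChange A x) =
      symPowAction A m (g.map (algebraMap O A)) (symPowBaseChange A m x) := by
  induction x using TensorProduct.induction_on with
  | zero => rw [map_zero, map_zero, map_zero]
  | tmul a p =>
    rw [LinearMap.baseChange_tmul, symPowBaseChange_tmul, symPowBaseChange_tmul,
      symPowMap_symPowAction, map_smul]
  | add x y hx hy => rw [map_add, map_add, hx, hy, map_add, map_add]

end BaseChange

/-! ### Reduction modulo an ideal -/

section Quotient

variable (I : Ideal O) (m : ℕ)

/-- **`Sym^m(𝒪²) / I·Sym^m(𝒪²) ≅ Sym^m((𝒪/I)²)`** (e.g. `I = (ϖ^r)`: the reductions of the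
lattice). [cite: Hida1994AIF, §1, (1.2b)] [cite: KhareThorne2017, §6.4] -/
def symPowQuotEquiv : (SymPow O m ⧸ (I • (⊤ : Submodule O (SymPow O m)))) ≃ₗ[O] SymPow (O ⧸ I) m :=
  (TensorProduct.quotTensorEquivQuotSMul (SymPow O m) I).symm ≪≫ₗ (symPowBaseChange (O ⧸ I) m).restrictScalars O

/-- **`symPowQuotEquiv` is reduction of coefficients**: the class of `p` maps to `p mod I`.
[cite: Hida1994AIF, §1] -/
@[simp]
theorem symPowQuotEquiv_mk (p : SymPow O m) :
    symPowQuotEquiv I m (Submodule.Quotient.mk p) = symPowMap (Ideal.Quotient.mk I) m p := by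
  rw [symPowQuotEquiv, LinearEquiv.trans_apply, LinearEquiv.restrictScalars_apply]
  have h : (TensorProduct.quotTensorEquivQuotSMul (SymPow O m) I).symm (Submodule.Quotient.mk p) =
      (1 : O ⧸ I) ⊗ₜ p := by
    rw [LinearEquiv.symm_apply_eq, ← map_one (Ideal.Quotient.mk I),
      TensorProduct.quotTensorEquivQuotSMul_mk_tmul, one_smul]
  rw [h, symPowBaseChange_tmul, one_smul, Ideal.Quotient.algebraMap_eq]

/-- The integral action preserves `I · Sym^m(𝒪²)`, so it descends to the quotient. [folklore] -/
theorem smul_top_le_comap_symPowAction (g : Matrix (Fin 2) (Fin 2) O) :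
    I • (⊤ : Submodule O (SymPow O m)) ≤ (I • (⊤ : Submodule O (SymPow O m))).comap (symPowAction O m g) := by
  rw [← Submodule.map_le_iff_le_comap, Submodule.map_smul'']
  exact Submodule.smul_mono le_rfl le_top

/-- **Reduction is `M₂(𝒪)`-equivariant**: the action induced on `Sym^m(𝒪²)/I·Sym^m` corresponds to
the action of `g mod I` on `Sym^m((𝒪/I)²)`. [cite: Hida1994AIF, §1] [cite: KhareThorne2017, §6.4] -/
theorem symPowQuotEquiv_symPowAction (g : Matrix (Fin 2) (Fin 2) O)
    (x : SymPow O m ⧸ (I • (⊤ : Submodule O (SymPow O m)))) :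
    symPowQuotEquiv I m (Submodule.mapQ _ _ (symPowAction O m g) (smul_top_le_comap_symPowAction I m g) x) =
      symPowAction (O ⧸ I) m (g.map (Ideal.Quotient.mk I)) (symPowQuotEquiv I m x) := by
  induction x using Submodule.Quotient.induction_on with
  | H p => rw [Submodule.mapQ_apply, symPowQuotEquiv_mk, symPowQuotEquiv_mk, symPowMap_symPowAction]

end Quotient

end Literature.NumberTheory.Automorphic.IntegralWeightGL2
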